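import Literature.AnabelianGeometry.EtaleTheta.Discharge.Sec1ZNUniquenessOfKummer
import Literature.AnabelianGeometry.EtaleTheta.Discharge.Sec2BarDeltaIndex
import Literature.AnabelianGeometry.EtaleTheta.Discharge.Sec1CuspInertiaEllDivisible
import Literature.AnabelianGeometry.EtaleTheta.Discharge.Sec1CompatOfSetting
import Literature.AnabelianGeometry.EtaleTheta.Discharge.Sec1CompatHolds
import Literature.AnabelianGeometry.EtaleTheta.ThetaCyclotomes
import Literature.AnabelianGeometry.EtaleTheta.SettingModelChiZNStandardSplitting
import Literature.AnabelianGeometry.EtaleTheta.SettingModelTateZNStandardSplitting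
import Literature.AnabelianGeometry.EtaleTheta.SettingModelChiTheta
import Literature.AnabelianGeometry.EtaleTheta.SettingModelTateTheta
import HarnessLib

/-!
# [EtTh] §1 p. 14 / p. 20: `θ(Π^tp_{Z_N}) ∩ Δ_Θ = N·Δ_Θ` — the theta-image of `Π^tp_{Z_N}` meets `Δ_Θ` in its `N`-th powers
# (proof-only; from the ∃-form of the `Z_N` origin clause and the freeness guard; model instances by name)

Mochizuki, *The étale theta function and its Frobenioid-theoretic manifestations*, Publ. RIMS **45** (2009) [EtTh], §1,
PRIMS p. 14 «`1 → Δ_Θ ⊗ ℤ/Nℤ → Gal(Z_N/Y_N) → Gal(J_N/K_N) → 1`», p. 20 «`Δ^tp_{Ÿ_N}/Δ^tp_{Z̈_N} ≅ Δ_Θ ⊗ ℤ/Nℤ`»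
[cite: MochizukiEtTh2009, §1 p.14].  abc-iut cell, layer L2 = [EtTh], seat abc-iut-w6-d061 (gen 9), row «ZN-INTERSECTION Q»
(abc-iut-L2-lead R1209/R1222/R1239; root owner abc-iut-L2-t1's answer of record STATUS 05:53:19Z — cited, not redone; this seat's
concordant memo HOME/staging/w6/w6-d061/g9/ANSWER-ZN-Intersection-Q.md).  PROOF-ONLY: no definition, no new named fact.
WHY A CLAUSE: the root record `Setting.lean` v3 fixes for `Π^tp_{Z_N}` only index / Galois-image / normality data, not the
position of `Δ^tp_{Z_N}` in the `Δ_Θ`-direction (abc-iut-L2-t1's counter-shape); the statement follows from print's DEFINITION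
of `Z_N`, carried by the ∃-form of the origin clause `GtpZNFromSplitting` (abc-iut-L2-t1 / abc-iut-w5-d062) — a DISPLAYED
hypothesis, inhabited at the models.  The «no `N`-torsion in `(Δ^tp_Y)^ell`» input is NOT displayed: it is abc-iut-L2-d3's
THEOREM `mem_deltaTheta_of_pow_mem` under the freeness guard.  Consumed BY NAME: `mem_GtpZN_iff_toTheta_mem_of_clause`
(abc-iut-w5-d062), `dtpYTheta_comm` (abc-iut-L2-t8), `deltaTheta_le_DtpYTheta`, `dtpYN_normal`, `relIndex_deltaYN`,
`ker_toTheta_le_deltaTemp`, `lDeltaTheta`, `IsTateOrigin.dtpYN_eq`, and the model facts `exists_thetaSplitting_gtpZN_iff_modelχ(q)`,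
`modelχ(q)_isEtThOrigin` (abc-iut-L2-d1 / abc-iut-L2-t6 lineages).
* `map_toTheta_gtpZN_inf_deltaTheta` — **`θ(Π^tp_{Z_N}) ∩ Δ_Θ = N·Δ_Θ`** ⟸ {freeness guard, ∃-form of the clause};
* `map_toTheta_gtpZddN_inf_deltaTheta` — the `Z̈_N` form given `Δ_Θ ≤ θ(Δ^tp_{Y_{2N}})`, and `…_of_isTateOrigin` discharging that
  input at Tate origins (R2 at every level + a cusp);
* `lDeltaTheta_inf_map_toTheta_gtpZN` — abc-iut-L2-t4's (★) shape for Def. 5.4 (b): `l·Δ_Θ ∩ θ(Π^tp_{Z_{l·N}}) = (l·N)·Δ_Θ`;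
* `map_toTheta_gtpZN_inf_deltaTheta_modelχ` / `_modelχq` — the `Z_N` statement at both semi-synthetic models, by name.
HONEST FRAMING: [EtTh] is refereed; clauses are hypotheses inhabited at semi-synthetic models, never asserted for an abstract `D`;
nothing here bears on [IUTchIII] Cor. 3.12; no side taken; typed ≠ proved.
-/

noncomputable section

namespace Literature.AnabelianGeometry.EtaleTheta

open Literature.AnabelianGeometry.SemiGraphs

namespace ThetaSetting

variable {p : ℕ} [Fact p.Prime] (D : ThetaSetting p) (N : ℕ+)

/-! ### Root-level bookkeeping -/

/-- **`y ∈ Δ^tp_Y ⇒ y^N ∈ Δ^tp_{Y_N}`** («`Δ^tp_Y/Δ^tp_{Y_N} ≅ ℤ/Nℤ(1)`», p. 16): the quotient has order `N` (root field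
`relIndex_deltaYN`) and `Δ^tp_{Y_N}` is normal. [cite: MochizukiEtTh2009, §1 p.16] -/
theorem pow_mem_dtpYN_of_mem_dtpY {y : D.PiTemp} (hy : y ∈ D.DtpY) : y ^ (N : ℕ) ∈ D.DtpYN N := by
  haveI := D.dtpYN_normal N
  have hidx : (D.DtpYN N).relIndex D.DtpY = N := by exact_mod_cast D.relIndex_deltaYN N
  have h := (D.DtpYN N).pow_relIndex_mem hy
  rwa [hidx] at h

/-- `N`-th powers of `(Δ^tp_Y)^Θ` lie in `N·(Δ^tp_Y)^Θ`. [cite: MochizukiEtTh2009, §1 p.14] -/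
theorem pow_mem_thetaPowersY {u : D.GtpTheta} (hu : u ∈ D.DtpYTheta) : u ^ (N : ℕ) ∈ D.thetaPowersY N :=
  Subgroup.subset_closure ⟨u, hu, rfl⟩

/-- **Under the freeness guard every element of `N·(Δ^tp_Y)^Θ` is an `N`-th power of an element of `(Δ^tp_Y)^Θ`**
(«abelian profinite groups `1 → Δ_Θ → (Δ^tp_Y)^Θ → (Δ^tp_Y)^ell → 1`», p. 12: in an abelian group the `N`-th powers form a
subgroup). [cite: MochizukiEtTh2009, §1 p.12] -/
theorem exists_eq_pow_of_mem_thetaPowersY (hO : D.IsEtThOrigin) {t : D.GtpTheta} (ht : t ∈ D.thetaPowersY N) :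
    ∃ u ∈ D.DtpYTheta, u ^ (N : ℕ) = t := by
  induction ht using Subgroup.closure_induction with
  | mem x hx =>
    obtain ⟨u, hu, rfl⟩ := hx
    exact ⟨u, hu, rfl⟩
  | one => exact ⟨1, one_mem _, one_pow _⟩
  | mul x y _ _ ihx ihy =>
    obtain ⟨u, hu, rfl⟩ := ihx
    obtain ⟨v, hv, rfl⟩ := ihy
    refine ⟨u * v, mul_mem hu hv, ?_⟩
    have huv : Commute u v := D.dtpYTheta_comm hO u hu v hv
    exact huv.mul_pow _
  | inv x _ ihx =>
    obtain ⟨u, hu, rfl⟩ := ihx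
    exact ⟨u⁻¹, inv_mem hu, by rw [inv_pow]⟩

/-- **`Δ_Θ ∩ N·(Δ^tp_Y)^Θ = N·Δ_Θ`** under the freeness guard: `⊇` is clear; for `⊆`, an element of `N·(Δ^tp_Y)^Θ` is `u^N`
with `u ∈ (Δ^tp_Y)^Θ`, and `u^N ∈ Δ_Θ` forces `u ∈ Δ_Θ` because `(Δ^tp_X)^ell` is torsion-free
(`mem_deltaTheta_of_pow_mem`). [cite: MochizukiEtTh2009, §1 p.12] -/
theorem deltaTheta_inf_thetaPowersY (hO : D.IsEtThOrigin) :
    D.DeltaTheta ⊓ D.thetaPowersY N = D.lDeltaTheta N := by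
  ext t
  constructor
  · rintro ⟨htΔ, htP⟩
    obtain ⟨u, hu, rfl⟩ := D.exists_eq_pow_of_mem_thetaPowersY N hO htP
    have huΘ : u ∈ D.DtpTheta := by
      obtain ⟨y, hy, rfl⟩ := hu
      exact ⟨y, (Subgroup.mem_inf.mp hy).2, rfl⟩
    have huΔ : u ∈ D.DeltaTheta := D.mem_deltaTheta_of_pow_mem hO huΘ (PNat.ne_zero N) htΔ
    exact ⟨u, huΔ, rfl⟩
  · rintro ⟨d, hd, rfl⟩
    exact ⟨pow_mem hd _, D.pow_mem_thetaPowersY N (D.deltaTheta_le_DtpYTheta hd)⟩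

/-! ### The theta-image of `Π^tp_{Z_N}` -/

/-- An element of `Π^tp_X` whose theta-image lies in `Δ_Θ` is geometric (`Ker θ ≤ Δ^tp_X`, `Δ_Θ ≤ θ(Δ^tp_Y)`).
[cite: MochizukiEtTh2009, §1 p.12] -/
theorem mem_deltaTemp_of_toTheta_mem_deltaTheta {g : D.PiTemp} (hg : D.toTheta g ∈ D.DeltaTheta) : g ∈ D.DeltaTemp := by
  obtain ⟨y, hy, hyg⟩ := D.deltaTheta_le_DtpYTheta hg
  have hk : g * y⁻¹ ∈ D.toTheta.ker := by
    rw [MonoidHom.mem_ker, map_mul, map_inv, ← hyg, mul_inv_cancel]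
  have hk' : g * y⁻¹ ∈ D.DeltaTemp := D.ker_toTheta_le_deltaTemp hk
  have := mul_mem hk' (Subgroup.mem_inf.mp hy).2
  rwa [inv_mul_cancel_right] at this

/-- **`θ(Π^tp_{Z_N}) ∩ Δ_Θ = N·Δ_Θ`** (p. 14 «`1 → Δ_Θ ⊗ ℤ/Nℤ → Gal(Z_N/Y_N) → …`»), from the freeness guard and the ∃-form of the
`Z_N` origin clause: SOME lifted splitting `s₀` over `G_{K_N}` cuts out `Π^tp_{Z_N}` (print's definition of `Z_N`; at joint origins
the ∀-form `GtpZNFromSplitting` follows, abc-iut-w5-d062).  `⊆`: a geometric element of `Π^tp_{Z_N}` has theta-image in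
`N·(Δ^tp_Y)^Θ` (`mem_GtpZN_iff_toTheta_mem_of_clause`), and `Δ_Θ ∩ N·(Δ^tp_Y)^Θ = N·Δ_Θ`; `⊇`: `d = θ(y)`, `y ∈ Δ^tp_Y`, and
`y^N ∈ Δ^tp_{Y_N}` has theta-image `d^N ∈ N·(Δ^tp_Y)^Θ`, so `y^N ∈ Π^tp_{Z_N}`. [cite: MochizukiEtTh2009, §1 p.14] -/
theorem map_toTheta_gtpZN_inf_deltaTheta (hO : D.IsEtThOrigin) {s₀ : ↥(D.GKN N) → D.GtpTheta}
    (hs₀ : D.IsThetaSplittingAt N s₀)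
    (hcl : ∀ g : D.PiTemp, g ∈ D.GtpZN N ↔ g ∈ D.GtpYN N ∧ ∃ h : D.aug g ∈ D.GJN N,
      D.toTheta g * (s₀ ⟨D.aug g, D.GJN_le_GKN N h⟩)⁻¹ ∈ D.thetaPowersY N) :
    (D.GtpZN N).map D.toTheta ⊓ D.DeltaTheta = D.lDeltaTheta N := by
  ext t
  constructor
  · rintro ⟨⟨g, hgZ, rfl⟩, htΔ⟩
    have hgΔ : g ∈ D.DeltaTemp := D.mem_deltaTemp_of_toTheta_mem_deltaTheta htΔ
    have hgYN : g ∈ D.DtpYN N := Subgroup.mem_inf.mpr ⟨D.GtpZN_le N hgZ, hgΔ⟩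
    have hP : D.toTheta g ∈ D.thetaPowersY N := (D.mem_GtpZN_iff_toTheta_mem_of_clause hs₀ hcl hgYN).mp hgZ
    have : D.toTheta g ∈ D.DeltaTheta ⊓ D.thetaPowersY N := ⟨htΔ, hP⟩
    rwa [D.deltaTheta_inf_thetaPowersY N hO] at this
  · rintro ⟨d, hd, rfl⟩
    obtain ⟨y, hy, rfl⟩ := D.deltaTheta_le_DtpYTheta hd
    have hyN : y ^ (N : ℕ) ∈ D.DtpYN N := D.pow_mem_dtpYN_of_mem_dtpY N hy
    have hP : D.toTheta (y ^ (N : ℕ)) ∈ D.thetaPowersY N := by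
      rw [map_pow]; exact D.pow_mem_thetaPowersY N ⟨y, hy, rfl⟩
    have hZ : y ^ (N : ℕ) ∈ D.GtpZN N := (D.mem_GtpZN_iff_toTheta_mem_of_clause hs₀ hcl hyN).mpr hP
    exact ⟨⟨y ^ (N : ℕ), hZ, by rw [map_pow]⟩, pow_mem hd _⟩

/-- **`θ(Π^tp_{Z̈_N}) ∩ Δ_Θ = N·Δ_Θ`** (p. 20 «`Δ^tp_{Ÿ_N}/Δ^tp_{Z̈_N} ≅ Δ_Θ ⊗ ℤ/Nℤ`»), for `Π^tp_{Z̈_N} = Π^tp_{Ÿ_N} ∩ Π^tp_{Z_N}`: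
as for `Z_N`, given in addition that `Δ_Θ ≤ θ(Δ^tp_{Y_{2N}})` (the `Ÿ_N`-part only tightens the ell-coordinate; the input is a
theorem at Tate origins, next lemma). [cite: MochizukiEtTh2009, §1 p.20] -/
theorem map_toTheta_gtpZddN_inf_deltaTheta (hO : D.IsEtThOrigin) {s₀ : ↥(D.GKN N) → D.GtpTheta}
    (hs₀ : D.IsThetaSplittingAt N s₀)
    (hcl : ∀ g : D.PiTemp, g ∈ D.GtpZN N ↔ g ∈ D.GtpYN N ∧ ∃ h : D.aug g ∈ D.GJN N,
      D.toTheta g * (s₀ ⟨D.aug g, D.GJN_le_GKN N h⟩)⁻¹ ∈ D.thetaPowersY N)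
    (hΘ : D.DeltaTheta ≤ (D.DtpYN (2 * N)).map D.toTheta) :
    (D.GtpZddN N).map D.toTheta ⊓ D.DeltaTheta = D.lDeltaTheta N := by
  apply le_antisymm
  · calc (D.GtpZddN N).map D.toTheta ⊓ D.DeltaTheta
        ≤ (D.GtpZN N).map D.toTheta ⊓ D.DeltaTheta :=
          inf_le_inf_right _ (Subgroup.map_mono (inf_le_right : D.GtpZddN N ≤ D.GtpZN N))
      _ = D.lDeltaTheta N := D.map_toTheta_gtpZN_inf_deltaTheta N hO hs₀ hcl
  · rintro _ ⟨d, hd, rfl⟩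
    obtain ⟨y, hy2N, rfl⟩ := hΘ hd
    obtain ⟨hyY2N, hyΔ⟩ := Subgroup.mem_inf.mp hy2N
    have hyY : y ∈ D.DtpY := D.dtpYN_le_dtpY (2 * N) hy2N
    have hyN : y ^ (N : ℕ) ∈ D.DtpYN N :=
      Subgroup.mem_inf.mpr ⟨D.GtpYN_anti N (2 * N) (Dvd.intro_left 2 rfl) (pow_mem hyY2N _), pow_mem hyΔ _⟩
    have hP : D.toTheta (y ^ (N : ℕ)) ∈ D.thetaPowersY N := by
      rw [map_pow]; exact D.pow_mem_thetaPowersY N ⟨y, hyY, rfl⟩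
    have hZ : y ^ (N : ℕ) ∈ D.GtpZN N := (D.mem_GtpZN_iff_toTheta_mem_of_clause hs₀ hcl hyN).mpr hP
    have hJ : y ^ (N : ℕ) ∈ (D.GJddN N).comap D.aug.toMonoidHom := by
      rw [Subgroup.mem_comap, map_pow]
      have hy1 : D.aug.toMonoidHom y = 1 := hyΔ
      rw [hy1, one_pow]
      exact one_mem _
    have hYdd : y ^ (N : ℕ) ∈ D.GtpYddN N := Subgroup.mem_inf.mpr ⟨pow_mem hyY2N _, hJ⟩
    exact ⟨⟨y ^ (N : ℕ), Subgroup.mem_inf.mpr ⟨hYdd, hZ⟩, by rw [map_pow]⟩, pow_mem hd _⟩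

/-- The input `Δ_Θ ≤ θ(Δ^tp_{Y_M})` of the `Z̈_N` statement is a THEOREM at Tate origins: `Δ^tp_{Y_M}` is the `M`-th-power
locus of `(Δ^tp_Y)^ell` (`IsTateOrigin.dtpYN_eq`, ⟸ R2 `GtpYNFromCusp` at every level + a cusp in `Π^tp_Y`), and `Δ_Θ` is killed
by `(·)^ell`. [cite: MochizukiEtTh2009, §1 p.16] -/
theorem deltaTheta_le_map_toTheta_dtpYN_of_isTateOrigin (hT : D.IsTateOrigin)
    (hR2 : ∀ M : ℕ+, Thm16Sub.GtpYNFromCusp D M)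
    (hcusp : ∃ Dc : Subgroup D.PiTemp, D.IsCuspidalDecompositionGroup Dc ∧ Dc ≤ D.GtpY) (M : ℕ+) :
    D.DeltaTheta ≤ (D.DtpYN M).map D.toTheta := by
  intro d hd
  obtain ⟨y, hy, rfl⟩ := D.deltaTheta_le_DtpYTheta hd
  refine ⟨y, ?_, rfl⟩
  rw [hT.dtpYN_eq hR2 hcusp M]
  refine Subgroup.mem_inf.mpr ⟨hy, ?_⟩
  rw [Subgroup.mem_comap]
  have h1 : Thm16Sub.toEll D y = 1 := by
    change D.thetaToEll (D.toTheta y) = 1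
    exact hd
  rw [h1]
  exact one_mem _

/-- **`θ(Π^tp_{Z̈_N}) ∩ Δ_Θ = N·Δ_Θ` at Tate origins** (freeness guard, `IsTateOrigin`, R2 at every level, a cusp in `Π^tp_Y`, and
the ∃-form of the `Z_N` clause). [cite: MochizukiEtTh2009, §1 p.20] -/
theorem map_toTheta_gtpZddN_inf_deltaTheta_of_isTateOrigin (hO : D.IsEtThOrigin) (hT : D.IsTateOrigin)
    (hR2 : ∀ M : ℕ+, Thm16Sub.GtpYNFromCusp D M)
    (hcusp : ∃ Dc : Subgroup D.PiTemp, D.IsCuspidalDecompositionGroup Dc ∧ Dc ≤ D.GtpY)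
    {s₀ : ↥(D.GKN N) → D.GtpTheta} (hs₀ : D.IsThetaSplittingAt N s₀)
    (hcl : ∀ g : D.PiTemp, g ∈ D.GtpZN N ↔ g ∈ D.GtpYN N ∧ ∃ h : D.aug g ∈ D.GJN N,
      D.toTheta g * (s₀ ⟨D.aug g, D.GJN_le_GKN N h⟩)⁻¹ ∈ D.thetaPowersY N) :
    (D.GtpZddN N).map D.toTheta ⊓ D.DeltaTheta = D.lDeltaTheta N :=
  D.map_toTheta_gtpZddN_inf_deltaTheta N hO hs₀ hcl (D.deltaTheta_le_map_toTheta_dtpYN_of_isTateOrigin hT hR2 hcusp (2 * N))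

/-! ### The shape consumed by Def. 5.4 (b) / Prop. 5.5 at settings: `l·Δ_Θ ∩ θ(Π^tp_{Z_{l·N}}) = (l·N)·Δ_Θ` -/

/-- `(l·N)·Δ_Θ ≤ l·Δ_Θ`. [cite: MochizukiEtTh2009, Prop 2.12 (i) p.45] -/
theorem lDeltaTheta_mul_le (l : ℕ) : D.lDeltaTheta (l * N) ≤ D.lDeltaTheta l := by
  rintro _ ⟨d, hd, rfl⟩
  exact ⟨d ^ (N : ℕ), pow_mem hd _, by rw [← pow_mul, mul_comm]⟩

/-- **`l·Δ_Θ ∩ θ(Π^tp_{Z_{l·N}}) = (l·N)·Δ_Θ`** — the subgroup form of «`(l·Δ_Θ)_S ⊗ ℤ/Nℤ` has cardinality `N`» for `S^bs`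
over `Z_{l·N}` (Def. 5.4 (b) p. 327; abc-iut-L2-t4's (★) `l·Δ_Θ ∩ q(V) = Ker(μ.red)`), from the `Z_{l·N}` statement.
[cite: MochizukiEtTh2009, Def 5.4 p.101] -/
theorem lDeltaTheta_inf_map_toTheta_gtpZN (hO : D.IsEtThOrigin) (l : ℕ+) {s₀ : ↥(D.GKN (l * N)) → D.GtpTheta}
    (hs₀ : D.IsThetaSplittingAt (l * N) s₀)
    (hcl : ∀ g : D.PiTemp, g ∈ D.GtpZN (l * N) ↔ g ∈ D.GtpYN (l * N) ∧ ∃ h : D.aug g ∈ D.GJN (l * N),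
      D.toTheta g * (s₀ ⟨D.aug g, D.GJN_le_GKN (l * N) h⟩)⁻¹ ∈ D.thetaPowersY (l * N)) :
    D.lDeltaTheta l ⊓ (D.GtpZN (l * N)).map D.toTheta = D.lDeltaTheta (l * N) := by
  have key := D.map_toTheta_gtpZN_inf_deltaTheta (l * N) hO hs₀ hcl
  apply le_antisymm
  · rintro t ⟨htl, htZ⟩
    have htΔ : t ∈ D.DeltaTheta := D.lDeltaTheta_le l htl
    have : t ∈ (D.GtpZN (l * N)).map D.toTheta ⊓ D.DeltaTheta := ⟨htZ, htΔ⟩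
    rw [key] at this
    exact_mod_cast this
  · intro t ht
    have ht' : t ∈ D.lDeltaTheta ((l * N : ℕ+) : ℕ) := by exact_mod_cast ht
    refine ⟨?_, ?_⟩
    · have := D.lDeltaTheta_mul_le N l
      rw [show ((l : ℕ) * (N : ℕ)) = ((l * N : ℕ+) : ℕ) from (PNat.mul_coe l N).symm] at this
      exact this ht'
    · rw [← key] at ht'
      exact ht'.1

/-! ### The two semi-synthetic models of record (by name) -/

/-- **At the χ-twisted model `modelχ`**: `θ(Π^tp_{Z_N}) ∩ Δ_Θ = N·Δ_Θ` for every `N` — the ∃-form of the clause is abc-iut-L2-d1's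
`SettingModel.exists_thetaSplitting_gtpZN_iff_modelχ`, the guard is `modelχ_isEtThOrigin`. [cite: MochizukiEtTh2009, §1 p.14] -/
theorem map_toTheta_gtpZN_inf_deltaTheta_modelχ (p : ℕ) [Fact p.Prime] (N : ℕ+) :
    ((ThetaSetting.modelχ p).GtpZN N).map (ThetaSetting.modelχ p).toTheta ⊓ (ThetaSetting.modelχ p).DeltaTheta =
      (ThetaSetting.modelχ p).lDeltaTheta N := by
  obtain ⟨s, hs, hcl⟩ := SettingModel.exists_thetaSplitting_gtpZN_iff_modelχ p N
  exact (ThetaSetting.modelχ p).map_toTheta_gtpZN_inf_deltaTheta N (ThetaSetting.modelχ_isEtThOrigin p) hs hcl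

/-- **At the stage-2 model `modelχq p i j`** (`j` even): `θ(Π^tp_{Z_N}) ∩ Δ_Θ = N·Δ_Θ` for every `N`
(`SettingModel.exists_thetaSplitting_gtpZN_iff_modelχq`, `modelχq_isEtThOrigin`). [cite: MochizukiEtTh2009, §1 p.14] -/
theorem map_toTheta_gtpZN_inf_deltaTheta_modelχq (p : ℕ) [Fact p.Prime] (i j : ℤ) (hj : Even j) (N : ℕ+) :
    ((ThetaSetting.modelχq p i j hj).GtpZN N).map (ThetaSetting.modelχq p i j hj).toTheta ⊓
        (ThetaSetting.modelχq p i j hj).DeltaTheta = (ThetaSetting.modelχq p i j hj).lDeltaTheta N := by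
  obtain ⟨s, hs, hcl⟩ := SettingModel.exists_thetaSplitting_gtpZN_iff_modelχq p i j hj N
  exact (ThetaSetting.modelχq p i j hj).map_toTheta_gtpZN_inf_deltaTheta N (ThetaSetting.modelχq_isEtThOrigin p i j hj) hs hcl

end ThetaSetting

end Literature.AnabelianGeometry.EtaleTheta

end
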